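import Summits.ResolutionOfSingularities.ResolutionOfSingularities.Theorems.RadicialJungCleanModelsStubParameterSubset
import Mathlib.Algebra.Algebra.Tower
import Mathlib.Algebra.BigOperators.Group.Finset.Basic
import Mathlib.Algebra.Group.Submonoid.BigOperators
import Mathlib.Data.Fintype.EquivFin
import HarnessLib

/-!
# Stub `stub_parameterGenerises` for crux stmt-ResolutionOfSingularities-15917
(`RadicialJung.CleanModels`, line `Sketch`)

**Toroidal loose cleanness generises when some boundary parameter lies in `q`.** Let `O` be a
regular local ring with regular system of parameters `t : Fin d → O` (`(t) = 𝔪`, `d = dim O`),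
`x = u ∏_{i<m} t_i^{a_i}` with `u` a unit and exponents `a_i` prime to `p`, and `q` a prime of
`O` containing some boundary parameter `t_i`, `i < m`. At the localisation `O' = O_q` the
boundary parameters inside `q` are (the first `m'` members of) a generating family `t'` of
`𝔪_{O'}` of length `dim O'` (`stub_parameterSubset`), while `u` and the boundary parameters
outside `q` become units; hence `x = u' ∏_{j<m'} t'_j^{a'_j}` in any common `O'`-algebra `K`,
with `u'` a unit of `O'`, `0 < m'` and the `a'_j` (a subfamily of the `a_i`) prime to `p`.

Proof: finite-product bookkeeping. With `S = {i < m | t_i ∈ q}` (nonempty) enumerated by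
`e : Fin #S ≃ S`, apply `stub_parameterSubset` to the injective family `i ↦ t_{e i}`, put
`a'_j = a_{e j}`, `u' = u ∏_{i ∉ S} t_i^{a_i}` (outside `q`, so a unit of `O'`) and split
`∏_i = ∏_{i ∈ S} ∏_{i ∉ S}`.
-/

set_option linter.dupNamespace false

open IsLocalRing

namespace Summit.ResolutionOfSingularities.ResolutionOfSingularities.Theorems.RadicialJung.CleanModels

/-- **Toroidal loose cleanness generises when some boundary parameter lies in `q`.** Let `O` be
a regular local ring with regular system of parameters `t : Fin d → O`, `x = u ∏_{i<m} t_i^{a_i}`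
with `u` a unit and the `a_i` prime to `p`, and `q` a prime containing some `t_i`, `i < m`. Then
at a localisation `O'` of `O` at `q` there are a generating family `t' : Fin d' → O'` of
`𝔪_{O'}` with `d' = dim O'`, `0 < m' ≤ d'`, exponents `a'_j` prime to `p` and a unit `u'` with
`x = u' ∏_{j<m'} t'_j^{a'_j}` in any `O'`-algebra `K` compatible with `O → O'`. -/
theorem stub_parameterGenerises {O : Type*} [CommRing O] [IsRegularLocalRing O] (p : ℕ)
    {K : Type*} [CommRing K] [Algebra O K] {d m : ℕ} (hmd : m ≤ d) (t : Fin d → O)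
    (a : Fin m → ℕ) (u : O) (hu : IsUnit u) (ht : Ideal.span (Set.range t) = maximalIdeal O)
    (hd : ringKrullDim O = d) (ha : ∀ i, ¬ p ∣ a i) (q : Ideal O) [q.IsPrime]
    (hS : ∃ i : Fin m, t (Fin.castLE hmd i) ∈ q) (O' : Type*) [CommRing O'] [IsLocalRing O']
    [Algebra O O'] [IsLocalization.AtPrime O' q] [Algebra O' K] [IsScalarTower O O' K] :
    ∃ (d' m' : ℕ) (hmd' : m' ≤ d') (t' : Fin d' → O') (a' : Fin m' → ℕ) (u' : O'), IsUnit u' ∧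
      Ideal.span (Set.range t') = maximalIdeal O' ∧ ringKrullDim O' = (d' : WithBot ℕ∞) ∧
      0 < m' ∧ (∀ i, ¬ p ∣ a' i) ∧
      algebraMap O K (u * ∏ i : Fin m, t (Fin.castLE hmd i) ^ (a i)) =
        algebraMap O' K (u' * ∏ i : Fin m', t' (Fin.castLE hmd' i) ^ (a' i)) := by
  classical
  -- `S`: the indices of the boundary parameters lying in `q` (nonempty by `hS`)
  obtain ⟨S, hmemS⟩ : ∃ S : Finset (Fin m), ∀ i, i ∈ S ↔ t (Fin.castLE hmd i) ∈ q :=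
    ⟨Finset.univ.filter fun i => t (Fin.castLE hmd i) ∈ q, fun i => by simp⟩
  have hSne : S.Nonempty := by
    obtain ⟨i, hi⟩ := hS
    exact ⟨i, (hmemS i).mpr hi⟩
  -- an enumeration `e` of `S`; the family `j ↦ t_{e j}` is injective and lies in `q`
  obtain ⟨e⟩ : Nonempty (Fin S.card ≃ S) := ⟨S.equivFin.symm⟩
  have hι : Function.Injective fun j => Fin.castLE hmd (e j : Fin m) :=
    (Fin.castLE_injective hmd).comp (Subtype.val_injective.comp e.injective)
  have hιq : ∀ j, t (Fin.castLE hmd (e j : Fin m)) ∈ q := fun j => (hmemS _).mp (e j).2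
  -- the boundary parameters in `q` extend to a regular system of parameters of `O'`
  obtain ⟨d', hmd', t', ht', hd', ht'ι⟩ :=
    stub_parameterSubset t ht hd q (fun j => Fin.castLE hmd (e j : Fin m)) hι hιq O'
  -- `u` times the boundary monomials outside `q` lies outside `q`, so is a unit of `O'`
  have huq : u ∉ q := fun h => Ideal.IsPrime.ne_top ‹_› (Ideal.eq_top_of_isUnit_mem _ h hu)
  have hv : u * ∏ i ∈ Sᶜ, t (Fin.castLE hmd i) ^ a i ∈ q.primeCompl := by
    refine mul_mem (Ideal.mem_primeCompl_iff.mpr huq) (prod_mem fun i hi => pow_mem ?_ _)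
    exact Ideal.mem_primeCompl_iff.mpr fun h => Finset.mem_compl.mp hi ((hmemS i).mpr h)
  refine ⟨d', S.card, hmd', t', fun j => a (e j), algebraMap O O'
    (u * ∏ i ∈ Sᶜ, t (Fin.castLE hmd i) ^ a i), IsLocalization.map_units O' ⟨_, hv⟩, ht', hd',
    Finset.card_pos.mpr hSne, fun j => ha _, ?_⟩
  -- the identity in `K`: split `∏_i = ∏_{i ∉ S} * ∏_{i ∈ S}` and reindex `∏_{i ∈ S}` along `e`
  have key : u * ∏ i, t (Fin.castLE hmd i) ^ a i = (u * ∏ i ∈ Sᶜ, t (Fin.castLE hmd i) ^ a i) *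
      ∏ j : Fin S.card, t (Fin.castLE hmd (e j : Fin m)) ^ a (e j) := by
    have h1 : ∏ j : Fin S.card, t (Fin.castLE hmd (e j : Fin m)) ^ a (e j) =
        ∏ i ∈ S, t (Fin.castLE hmd i) ^ a i := by
      rw [← Finset.prod_coe_sort S]
      exact Fintype.prod_equiv e _ _ fun j => rfl
    rw [h1, mul_assoc, Finset.prod_compl_mul_prod]
  rw [key, IsScalarTower.algebraMap_apply O O' K, map_mul (algebraMap O O'), map_prod]
  simp_rw [map_pow, ht'ι]

end Summit.ResolutionOfSingularities.ResolutionOfSingularities.Theorems.RadicialJung.CleanModels
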